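import Literature.IUT.LogVolume.DegreeVolumeConversion
import Mathlib.Tactic.FieldSimp
import Mathlib.Tactic.Ring
import HarnessLib

/-!
# "Mochizuki-normalised" log-measures: Dupuy–Hilado Rmk. 3.5.4 and Lemma 3.5.5 for the packet interface

Dupuy–Hilado, arXiv:2004.13228 (pre-split text; Ramanujan J. **68** (2025)) §3.5, read on the page (corpus
render `paper:arxiv-2004.13228`, chunk 9):

* Rmk. 3.5.4: "If `W = ⊕ W_i` is a `p`-adic Mochizuki measure space and each `W_i` is a `L`-vector space then
  we say `Pr : {1,…,m} → ℝ` is Mochizuki normalized if for every `x ∈ L` and every `U = ⊕_{i=1}^m U_i ∈ M(W)` we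
  have `ln ν̄(xU) = log|x|_p + ln ν̄(U)`. All of our expected log measures of `p`-adic vector space will be
  Mochizuki normalized. The property of being Mochizuki normalized does not uniquely specify the weights of our
  expectations. This is a common misconception."
* Lemma 3.5.5: "If `W` is a `ℚ_p`-vector space which admits a decomposition `W = ⊕_{i=1}^m W_i` then
  `log μ̄_W(U) = ln ν̄_W(U)`, where we define `Pr : {1,…,m} → ℝ` by `Pr(i) = dim(W_i)/dim(W)`."
* §2.4.6: "The first norm is `|x|_p := p^{−ord_p(x)}` where `ord_p` is the valuation normalized so that
  `ord_p(p) = 1`."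

This file PROVES both for the packet interface of `DegreeVolumeConversion` (`PacketModel`), whose only measure
axiom is (3.7)+(3.4) `log μ̄_{v⃗}(a·U) = −ord_v(a)·ln|κ(v)|/n_v + log μ̄_{v⃗}(U)`:

* `lnAbs_of_ordv_eq_mul_ramIdx`: a local scalar `a ∈ Λ_v` of valuation `ord_v(a) = k·e_v` — the valuation of
  `p^k` (`ord_v(p) = e_v`) — has `ln|a|_p = −k·log p`, the SAME for every place `v | p`
  (`ln|κ(v)| = f_v log p`, `n_v = e_v f_v`); hence Rmk. 3.5.4 at every level (`logμ_peel_ratPow`,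
  `lnνTensorPower_mochizukiNormalized`): scaling every summand of an admissible region by such scalars adds
  `−k·log p` to `ln ν̄_{𝔸^{⊗ j+1}_{V,p}}` — in particular "`μ^log(p·R) = −log p`"-type identities
  ([IUTchIV] Prop. 1.4; LANA §5.2 (e)) hold for the fake-adelic averages because `Σ_v Pr(v) = 1`, whatever
  the weights (DH: "does not uniquely specify the weights").
* `sum_div_sum_eq_expect` / `dimWeights`: Lemma 3.5.5 in its algebraic content — for dimensions `d_i > 0` and
  log-measures `m_i` of the summands, `(Σ m_i)/(Σ d_i) = 𝔼(m_i/d_i)` for `Pr(i) = d_i/Σ d_j` (the measure-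
  theoretic input `log μ_W(⊕U_i) = Σ log μ_{W_i}(U_i)` for product measures is the packet files' business).

[cite: DupuyHilado2025, Rmk. 3.5.4, Lemma 3.5.5, §2.4.6] Deliberately NOT here: product Haar measures; anything
about Cor. 3.12.
-/

noncomputable section

namespace Literature.IUT.LogVolume

open NumberField IsDedekindDomain Finset

variable (F : Type*) [Field F] [NumberField F]

/-! ## Lemma 3.5.5: dimension weights -/

/-- The probability space `Pr(i) = d_i/Σ_j d_j` on a non-empty finite index set with positive "dimensions"
`d_i` (Lemma 3.5.5: "`Pr(i) = dim(W_i)/dim(W)`"). [cite: DupuyHilado2025, Lemma 3.5.5] -/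
def dimWeights {ι : Type*} [Fintype ι] [Nonempty ι] (d : ι → ℝ) (hd : ∀ i, 0 < d i) : ProbWeights ι where
  pr i := d i / ∑ j, d j
  pr_nonneg i := div_nonneg (hd i).le (Finset.sum_nonneg fun j _ => (hd j).le)
  sum_pr := by
    have hs : 0 < ∑ j, d j := Finset.sum_pos (fun j _ => hd j) Finset.univ_nonempty
    rw [← Finset.sum_div, div_self hs.ne']

/-- **Lemma 3.5.5 (algebraic content)**: `(Σ_i m_i)/(Σ_i d_i) = 𝔼(m_i/d_i : Pr(i) = d_i/Σ d)` — the normalised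
log-measure of a direct sum (total log-measure over total dimension) is the dimension-weighted expectation of the
normalised log-measures of the summands. [cite: DupuyHilado2025, Lemma 3.5.5] -/
theorem sum_div_sum_eq_expect {ι : Type*} [Fintype ι] [Nonempty ι] (d m : ι → ℝ) (hd : ∀ i, 0 < d i) :
    (∑ i, m i) / (∑ i, d i) = (dimWeights d hd).expect (fun i => m i / d i) := by
  simp only [ProbWeights.expect, dimWeights]
  rw [Finset.sum_div]
  refine Finset.sum_congr rfl fun i _ => ?_
  have hi : d i ≠ 0 := (hd i).ne'
  field_simp

/-! ## Rmk. 3.5.4: the fake-adelic averages are Mochizuki-normalised -/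

namespace PacketModel

variable {F} (M : PacketModel F)

/-- `ln|a|_p = −k·log p` for a local scalar `a ∈ Λ_v`, `v | p`, of valuation `ord_v(a) = k·e_v` (the valuation
of `p^k`: `ord_v(p) = e_v`), independently of `v` — since `ln|κ(v)| = f_v·log p` and `n_v = e_v f_v` (§2.4.6
`|x|_p = p^{−ord_p(x)}`). [cite: DupuyHilado2025, §2.4.6, §3.4] -/
theorem lnAbs_of_ordv_eq_mul_ramIdx {p : ℕ} [Fact p.Prime] {v : placesOver F p} (a : M.Λ p v) (k : ℝ)
    (ha : M.ordv a = k * ramIdx F v.1) : M.lnAbs a = -k * Real.log p := by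
  have hv : residueChar F v.1 = p := (mem_placesOver_iff_residueChar v.1).mp v.2
  have he : (ramIdx F v.1 : ℝ) ≠ 0 := by exact_mod_cast ramIdx_ne_zero F v.1
  have hf : (resDeg F v.1 : ℝ) ≠ 0 := by exact_mod_cast resDeg_ne_zero F v.1
  rw [lnAbs, ha, logNorm_eq, hv, localDegree]
  push_cast
  field_simp

/-- **Rmk. 3.5.4 per summand**: scaling by such a scalar adds `−k·log p` to `log μ̄_{v⃗}`:
`log μ̄_{v⃗}(a·U) = −k·log p + log μ̄_{v⃗}(U)`. [cite: DupuyHilado2025, Rmk. 3.5.4] -/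
theorem logμ_peel_ratPow {p j : ℕ} [Fact p.Prime] {e : Fin (j + 1) → placesOver F p}
    (a : M.Λ p (e (Fin.last j))) (k : ℝ) (ha : M.ordv a = k * ramIdx F (e (Fin.last j)).1)
    {U : Set (M.X p j e)} (hU : M.adm U) :
    M.logμ (M.peel a '' U) = -k * Real.log p + M.logμ U := by
  rw [M.logμ_peel_eq a hU, M.lnAbs_of_ordv_eq_mul_ramIdx a k ha]

/-- **Rmk. 3.5.4 for `ln ν̄_{𝔸^{⊗ j+1}_{V̲,p}}`** ("Mochizuki normalized"): scaling EVERY summand of an admissible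
region by a scalar of valuation `k·e_{v_j}` (i.e. by "`p^k`" in the last tensor factor) adds `−k·log p` to the
fake-adelic average — because the weights sum to one, whatever they are ("does not uniquely specify the
weights"). [cite: DupuyHilado2025, Rmk. 3.5.4] -/
theorem lnνTensorPower_mochizukiNormalized (p : ℕ) [Fact p.Prime] (j : ℕ) (k : ℝ)
    (a : (e : Fin (j + 1) → placesOver F p) → M.Λ p (e (Fin.last j)))
    (ha : ∀ e, M.ordv (a e) = k * ramIdx F (e (Fin.last j)).1)
    (B B' : M.Region) (hB : M.RegionAdm B) (hB' : ∀ e, B' p j e = M.peel (a e) '' B p j e) :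
    M.lnνTensorPower p j B' = -k * Real.log p + M.lnνTensorPower p j B := by
  rw [M.lnνTensorPower_eq_expect, M.lnνTensorPower_eq_expect]
  have h : (fun e => M.logμ (B' p j e)) = fun e => -k * Real.log p + M.logμ (B p j e) := by
    funext e
    rw [hB' e, M.logμ_peel_ratPow (a e) k (ha e) (hB p j e)]
  rw [h, ProbWeights.expect_add, ProbWeights.expect_const]

end PacketModel

end Literature.IUT.LogVolume

end
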